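import Literature.Analysis.FluidPDE.TypeIAncientMild
import Literature.Analysis.FluidPDE.KatoLocalBoundedPicard
import Literature.Analysis.FluidPDE.KNSSRemark61
import Literature.Analysis.FluidPDE.CurlFreeLiouville
import Literature.Analysis.FluidPDE.LocalTypeI
import Literature.Analysis.UnboundedOperators.HeatKernelBoundedData
import HarnessLib

/-!
# Non-degeneracy of the tangent flow from persistence of the singularity
# (route `AdaptedFrequency`, item `TangentFlowTransfer`, stmt-NavierStokesRegularity-10494)

Helper file (all results proved). It reduces hypothesis (C) (non-degeneracy: `curl W(τ) ≢ 0`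
for every `τ < 0`) of `tangentFlowTransfer_of_nondegeneracy` to **persistence of the
singularity in the blow-up limit** (`IsBackwardSingularPoint W (0, 0)`, the conclusion of
Albritton–Barker 2019, Prop. 2.3 = `PersistenceOfSingularities`):

* `eq_const_of_slice_eq_const` — **forward uniqueness from a constant
  slice**: a Type-I ancient mild field which is a constant `b` at a time `τ₀ < 0` stays equal to
  `b` on `[τ₀, 0)` (the Oseen integral equation from `τ₀`, `e^{σΔ}b = b`, `B(b, b) = 0`,
  bilinearity `B(u,u) − B(b,b) = B(u − b, u) + B(b, u − b)` and the `L^∞` bound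
  `‖B(v, w)(t)‖ ≤ C‖v‖‖w‖√(t − s)` of the Kato theory iterated on short steps);
* `exists_curl_ne_zero_of_isBackwardSingularPoint` — if `curl W(τ₀) ≡ 0` then `W(τ₀)` is a
  bounded irrotational incompressible field, hence constant (`CurlFreeLiouville`), so `W` is that
  constant on `[τ₀, 0) × ℝ³`, essentially bounded on the parabolic cylinder of radius `√(−τ₀)` at
  the origin — contradicting persistence.
-/

noncomputable section

open MeasureTheory Set Function Filter TopologicalSpace Metric
open scoped Topology ENNReal

namespace Summit.NavierStokesRegularity.NavierStokesRegularity.Theorems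

open Literature.Analysis Literature.Analysis.FluidPDE

section General

variable {E : Type*} [NormedAddCommGroup E] [InnerProductSpace ℝ E] [FiniteDimensional ℝ E]
  [MeasurableSpace E] [BorelSpace E]

/-- Joint a.e. strong measurability of a Type-I ancient mild field on every slab below `0`.
[folklore] -/
theorem aestronglyMeasurable_slab_of_isTypeIAncientMild {C₀ : ℝ} {u : ℝ → E → E}
    (hu : IsTypeIAncientMild C₀ u) {s T : ℝ} (hT : T ≤ 0) :
    AEStronglyMeasurable (uncurry u) ((volume : Measure (ℝ × E)).restrict (Ioo s T ×ˢ univ)) := by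
  have hc : ContinuousOn (uncurry u) (Ioo s T ×ˢ univ) :=
    hu.contDiffOn.continuousOn.mono (prod_mono (fun t ht => lt_of_lt_of_le ht.2 hT) Subset.rfl)
  exact hc.aestronglyMeasurable (measurableSet_Ioo.prod MeasurableSet.univ)

/-- **One short step of forward uniqueness from a constant slice.** Let `u` be a Type-I ancient
mild field, `s < t₁ < 0`, `M = C₀/√(−t₁)` (a bound for `‖u‖` below `t₁`), `C` the constant of
`exists_norm_oseenDuhamel_le_mul` and `8 C M √δ ≤ 1`, `δ > 0`. If `u(s, ·) ≡ b` then `u ≡ b` on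
`(s, min (s + δ) t₁] × E` (the deviation from `b` halves at each use of the integral equation).
[folklore] -/
theorem eq_const_step_of_isTypeIAncientMild {C₀ : ℝ} {u : ℝ → E → E} (hu : IsTypeIAncientMild C₀ u)
    {C : ℝ} (hC : 0 < C)
    (hB : ∀ {ν : ℝ}, 0 < ν → ∀ {v w : ℝ → E → E} {s t Mu Mv : ℝ}, s < t → 0 ≤ Mu → 0 ≤ Mv →
      (∀ τ ∈ Ioo s t, ∀ y, ‖v τ y‖ ≤ Mu) → (∀ τ ∈ Ioo s t, ∀ y, ‖w τ y‖ ≤ Mv) → ∀ x : E,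
        ‖oseenDuhamel ν s v w t x‖ ≤ C * Mu * Mv * ν ^ (-(1 / 2 : ℝ)) * (2 * Real.sqrt (t - s)))
    {s t₁ δ : ℝ} (ht₁ : t₁ < 0) (hst₁ : s < t₁)
    (hδC : 8 * C * (C₀ / Real.sqrt (-t₁)) * Real.sqrt δ ≤ 1) {b : E} (hb : ∀ x, u s x = b) :
    ∀ t ∈ Ioc s (min (s + δ) t₁), ∀ x, u t x = b := by
  set M : ℝ := C₀ / Real.sqrt (-t₁) with hM
  have hC₀ : 0 ≤ C₀ := hu.nonneg
  have hM0 : 0 ≤ M := div_nonneg hC₀ (Real.sqrt_nonneg _)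
  -- `‖u‖ ≤ M` strictly below `t₁`
  have huM : ∀ τ < t₁, ∀ y, ‖u τ y‖ ≤ M := by
    intro τ hτ y
    refine (hu.norm_le (hτ.trans ht₁) y).trans ?_
    exact div_le_div_of_nonneg_left hC₀ (Real.sqrt_pos.2 (by linarith)) (Real.sqrt_le_sqrt (by linarith))
  have huM' : ∀ τ ≤ t₁, ∀ y, ‖u τ y‖ ≤ M := by
    intro τ hτ y
    rcases lt_or_eq_of_le hτ with h | rfl
    · exact huM τ h y
    · refine (hu.norm_le ht₁ y).trans le_rfl
  have hbM : ‖b‖ ≤ M := by rw [← hb 0]; exact huM s hst₁ 0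
  -- the constant field and measurability
  set bc : ℝ → E → E := fun _ _ => b with hbc
  have hmeas_u := aestronglyMeasurable_slab_of_isTypeIAncientMild hu (s := s) ht₁.le
  have hmeas_b : AEStronglyMeasurable (uncurry bc)
      ((volume : Measure (ℝ × E)).restrict (Ioo s t₁ ×ˢ univ)) := aestronglyMeasurable_const
  -- the halving induction
  set T : ℝ := min (s + δ) t₁ with hT
  have hTt₁ : T ≤ t₁ := min_le_right _ _
  have hclaim : ∀ n : ℕ, ∀ t ∈ Ioc s T, ∀ x, ‖u t x - b‖ ≤ 2 * M / 2 ^ n := by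
    intro n
    induction n with
    | zero =>
      intro t ht x
      rw [pow_zero, div_one]
      calc ‖u t x - b‖ ≤ ‖u t x‖ + ‖b‖ := norm_sub_le _ _
        _ ≤ M + M := add_le_add (huM' t (ht.2.trans hTt₁) x) hbM
        _ = 2 * M := by ring
    | succ n ih =>
      intro t ht x
      have hst : s < t := ht.1
      have htt₁ : t ≤ t₁ := ht.2.trans hTt₁
      have ht0 : t < 0 := lt_of_le_of_lt htt₁ ht₁
      -- the integral equation from `s`, for `u` and for the constant
      have hmild := hu.mild_eq_heatExtension hst ht0 x
      have hus : u s = fun _ => b := funext hb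
      rw [hus, UnboundedOperators.heatExtension_const b (sub_pos.2 hst)] at hmild
      -- `u t x - b = -(B(u,u) - B(b,b)) = -(B(u - b, u) + B(b, u - b))`
      have hBb : oseenDuhamel 1 s bc bc t x = 0 :=
        oseenDuhamel_eq_zero_of_const (b := fun _ => b) (c := fun _ => b)
          (fun τ _ y => rfl) (fun τ _ y => rfl) x
      have hsplit := oseenDuhamel_self_sub_self (ν := 1) (s := s) (T := t₁) one_pos hmeas_u hmeas_b
        (fun τ hτ y => huM τ hτ.2 y) (fun τ _ y => hbM) hst htt₁ x
      rw [hBb, sub_zero] at hsplit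
      have hdiff : u t x - b = -(oseenDuhamel 1 s (fun τ y => u τ y - bc τ y) u t x +
          oseenDuhamel 1 s bc (fun τ y => u τ y - bc τ y) t x) := by
        rw [← hsplit, hmild]; abel
      -- bounds of the two Duhamel terms with the induction hypothesis on `(s, t)`
      have hD : ∀ τ ∈ Ioo s t, ∀ y, ‖u τ y - bc τ y‖ ≤ 2 * M / 2 ^ n := fun τ hτ y =>
        ih τ ⟨hτ.1, hτ.2.le.trans ht.2⟩ y
      have hDn : 0 ≤ 2 * M / 2 ^ n := by positivity
      have h1 := hB one_pos (v := fun τ y => u τ y - bc τ y) (w := u) hst hDn hM0 hD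
        (fun τ hτ y => huM τ (hτ.2.trans_le htt₁) y) x
      have h2 := hB one_pos (v := bc) (w := fun τ y => u τ y - bc τ y) hst hM0 hDn
        (fun τ _ y => hbM) hD x
      rw [Real.one_rpow, mul_one] at h1 h2
      have hsq : Real.sqrt (t - s) ≤ Real.sqrt δ := Real.sqrt_le_sqrt (by
        have := ht.2.trans (min_le_left _ _); linarith)
      rw [hdiff, norm_neg]
      refine (norm_add_le _ _).trans ?_
      have hkey : C * (2 * M / 2 ^ n) * M * (2 * Real.sqrt (t - s)) +
          C * M * (2 * M / 2 ^ n) * (2 * Real.sqrt (t - s)) ≤ 2 * M / 2 ^ (n + 1) := by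
        have e : C * (2 * M / 2 ^ n) * M * (2 * Real.sqrt (t - s)) +
            C * M * (2 * M / 2 ^ n) * (2 * Real.sqrt (t - s)) =
            (8 * C * M * Real.sqrt (t - s)) * (M / 2 ^ n) := by ring
        have e2 : 2 * M / 2 ^ (n + 1) = M / 2 ^ n := by rw [pow_succ]; field_simp
        rw [e, e2]
        have h3 : 8 * C * M * Real.sqrt (t - s) ≤ 1 := by
          calc 8 * C * M * Real.sqrt (t - s) ≤ 8 * C * M * Real.sqrt δ := by
                exact mul_le_mul_of_nonneg_left hsq (by positivity)
            _ ≤ 1 := hδC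
        calc (8 * C * M * Real.sqrt (t - s)) * (M / 2 ^ n) ≤ 1 * (M / 2 ^ n) :=
              mul_le_mul_of_nonneg_right h3 (by positivity)
          _ = M / 2 ^ n := one_mul _
      linarith
  -- conclusion: the deviation is below every `2M/2^n`
  intro t ht x
  have h0 : ‖u t x - b‖ ≤ 0 := by
    refine le_of_forall_pos_le_add fun ε hε => ?_
    obtain ⟨n, hn⟩ : ∃ n : ℕ, 2 * M / 2 ^ n < ε := by
      have ht : Tendsto (fun n : ℕ => 2 * M / 2 ^ n) atTop (𝓝 0) := by
        have := tendsto_pow_atTop_nhds_zero_of_lt_one (r := (1 / 2 : ℝ)) (by norm_num) (by norm_num)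
        have h := this.const_mul (2 * M)
        rw [mul_zero] at h
        refine h.congr fun n => ?_
        rw [one_div, inv_pow, div_eq_mul_inv]
      exact ((tendsto_order.1 ht).2 ε hε).exists
    rw [zero_add]
    exact ((hclaim n t ht x).trans hn.le)
  exact sub_eq_zero.1 (norm_le_zero_iff.1 h0)

/-- **Forward uniqueness from a constant slice for Type-I ancient mild fields.** If
`u(τ₀, ·) ≡ b` for some `τ₀ < 0` then `u ≡ b` on `[τ₀, 0) × E`. [folklore] -/
theorem eq_const_of_slice_eq_const {C₀ : ℝ} {u : ℝ → E → E}
    (hu : IsTypeIAncientMild C₀ u) {τ₀ : ℝ} (hτ₀ : τ₀ < 0) {b : E} (hb : ∀ x, u τ₀ x = b) :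
    ∀ t ∈ Ico τ₀ 0, ∀ x, u t x = b := by
  obtain ⟨C, hC, hB⟩ := exists_norm_oseenDuhamel_le_mul (E := E)
  -- it suffices to treat `t ≤ t₁` for every `t₁ ∈ (τ₀, 0)`
  suffices h : ∀ t₁ : ℝ, τ₀ < t₁ → t₁ < 0 → ∀ t ∈ Icc τ₀ t₁, ∀ x, u t x = b by
    intro t ht x
    rcases eq_or_lt_of_le ht.1 with rfl | hlt
    · exact hb x
    · exact h (t / 2) (by linarith) (by linarith [ht.2]) t ⟨ht.1, by linarith [ht.2]⟩ x
  intro t₁ hτt₁ ht₁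
  -- the step length
  set M : ℝ := C₀ / Real.sqrt (-t₁) with hM
  have hM0 : 0 ≤ M := div_nonneg hu.nonneg (Real.sqrt_nonneg _)
  set δ : ℝ := (1 / (8 * C * M + 1)) ^ 2 with hδ
  have hden : 0 < 8 * C * M + 1 := by positivity
  have hδ0 : 0 < δ := by rw [hδ]; positivity
  have hδC : 8 * C * M * Real.sqrt δ ≤ 1 := by
    rw [hδ, Real.sqrt_sq (by positivity)]
    rw [mul_one_div, div_le_one hden]
    linarith
  -- induction on the number of steps: `u ≡ b` on `[τ₀, min (τ₀ + k δ) t₁]`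
  have hind : ∀ k : ℕ, ∀ t ∈ Icc τ₀ (min (τ₀ + k * δ) t₁), ∀ x, u t x = b := by
    intro k
    induction k with
    | zero =>
      intro t ht x
      have : t = τ₀ := le_antisymm (ht.2.trans (by simp)) ht.1
      rw [this]; exact hb x
    | succ k ih =>
      intro t ht x
      set sk : ℝ := min (τ₀ + k * δ) t₁ with hsk
      rcases le_or_gt t sk with hle | hgt
      · exact ih t ⟨ht.1, hle⟩ x
      · -- one more step from `sk`, where `u ≡ b`
        have hsk_lt : sk < t₁ := lt_of_lt_of_le hgt (ht.2.trans (min_le_right _ _))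
        have hbk : ∀ y, u sk y = b := fun y => ih sk ⟨le_min (by
          have : (0:ℝ) ≤ k * δ := by positivity
          linarith) hτt₁.le, le_rfl⟩ y
        refine eq_const_step_of_isTypeIAncientMild hu hC (fun hν => hB hν) ht₁ hsk_lt hδC hbk t
          ⟨hgt, ?_⟩ x
        refine le_min ?_ (ht.2.trans (min_le_right _ _))
        have h1 : t ≤ τ₀ + (k + 1) * δ := ht.2.trans ((min_le_left _ _).trans (by push_cast; exact le_rfl))
        have h2 : sk = min (τ₀ + k * δ) t₁ := rfl
        rcases min_cases (τ₀ + ↑k * δ) t₁ with ⟨hm, -⟩ | ⟨hm, hlt⟩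
        · rw [hsk, hm]; linarith
        · -- `sk = t₁ < t` contradicts `t ≤ t₁`
          exfalso
          have : t ≤ t₁ := ht.2.trans (min_le_right _ _)
          rw [hsk, hm] at hgt
          linarith
  -- choose `k` with `k δ ≥ t₁ - τ₀`
  intro t ht x
  obtain ⟨k, hk⟩ := exists_nat_ge ((t₁ - τ₀) / δ)
  refine hind k t ⟨ht.1, le_min ?_ ht.2⟩ x
  have : t₁ - τ₀ ≤ k * δ := by rwa [div_le_iff₀ hδ0] at hk
  linarith [ht.2]

end General

/-! ### Non-degeneracy from persistence of the singularity -/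

local notation "ℝ³" => EuclideanSpace ℝ (Fin 3)

/-- **Non-degeneracy of a Type-I ancient mild field singular at the origin.** If `W` is a
Type-I ancient mild field with `(0, 0)` a backward singular point, then `curl W(τ) ≢ 0` for every
`τ < 0`: otherwise `W(τ)` is bounded, irrotational and incompressible, hence a constant `b`
(`eq_of_curl_eq_zero_of_isDivFree_of_bounded`), so `W ≡ b` on `[τ, 0) × ℝ³` (forward
uniqueness), and `W` is essentially bounded by `‖b‖` on the parabolic cylinder of radius `√(−τ)`
at the origin. [folklore] -/
theorem exists_curl_ne_zero_of_isBackwardSingularPoint {C₀ : ℝ} {W : ℝ → ℝ³ → ℝ³}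
    (hW : IsTypeIAncientMild C₀ W) (hsing : IsBackwardSingularPoint W ((0 : ℝ), (0 : ℝ³))) :
    ∀ τ < 0, ∃ x, curl (W τ) x ≠ 0 := by
  intro τ hτ
  by_contra hno
  push Not at hno
  -- `W τ` is constant
  have hW2 : ContDiff ℝ 2 (W τ) := contDiff_infty.1 (hW.contDiff_slice hτ) 2
  have hconst : ∀ x y, W τ x = W τ y :=
    eq_of_curl_eq_zero_of_isDivFree_of_bounded hW2 hno (hW.isDivFree hτ) (fun x => hW.norm_le hτ x)
  set b : ℝ³ := W τ 0 with hb
  have hbτ : ∀ x, W τ x = b := fun x => hconst x 0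
  -- forward uniqueness: `W ≡ b` on `[τ, 0)`
  have hfwd := eq_const_of_slice_eq_const hW hτ hbτ
  -- essential boundedness on the parabolic cylinder of radius `√(-τ)` at the origin
  set r : ℝ := Real.sqrt (-τ) with hr
  have hr0 : 0 < r := Real.sqrt_pos.2 (by linarith)
  have hr2 : r ^ 2 = -τ := by rw [hr, Real.sq_sqrt (by linarith)]
  have hcyl : parabolicCylinder r ((0 : ℝ), (0 : ℝ³)) ⊆ Ico τ 0 ×ˢ univ := by
    intro p hp
    simp only [parabolicCylinder, mem_prod, mem_Ioo, mem_ball] at hp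
    exact ⟨⟨by linarith [hp.1.1, hr2], hp.1.2⟩, mem_univ _⟩
  have hbound : eLpNorm (uncurry W) ∞ (volume.restrict (parabolicCylinder r ((0 : ℝ), (0 : ℝ³)))) ≤
      ENNReal.ofReal ‖b‖ := by
    refine eLpNorm_le_of_ae_bound (C := ‖b‖) ?_ |>.trans (by simp)
    rw [ae_restrict_iff' (isOpen_parabolicCylinder r _).measurableSet]
    refine Eventually.of_forall fun p hp => ?_
    obtain ⟨hpt, -⟩ := hcyl hp
    simp only [uncurry]
    rw [hfwd p.1 hpt p.2]
  have htop := hsing r hr0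
  rw [htop] at hbound
  exact absurd hbound (by simp)

end Summit.NavierStokesRegularity.NavierStokesRegularity.Theorems

end
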